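/-
Copyright (c) 2026 the pub-hodgecm-mathlib formalisation cell (harness21).  Prover seat hodgecm-mathlib-F0P3b-p01 (g25); E1 keeper ∕ dealer F0P3a-p03 (g29), E1 BRICK
LEDGER row 27c «JET-WINDOW @ DATUM» (keeper ruling 2026-09-03T01:14:52Z (j3); census `F0/P2/p02/g25/jet/CENSUS-JET-AT-DATUM.v1` 35cdd4c6 §(δ)).
-/
import Literature.RepresentationTheory.FirstOrderDeformationInvariantSubspace   -- ★ row 21 JET-WINDOW (F0P3a-p03 (g29)) p853103: `not_exists_equivariant_section_of_not_deforms`, `exists_equivariant_section_iff_deforms`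
import Literature.RepresentationTheory.CocycleExtensionTransversal             -- ★ row 26 TRANSVERSAL p853113: `exists_invariant_transversal_jetWindow_iff_deforms`, `not_transversal_range_of_not_deforms`
import Literature.RepresentationTheory.JetWindowTransfer                        -- ★ row 32 WINDOW TRANSFER p853122: `not_fills_of_not_deforms`, `deforms_of_equivariant_map_jet`
import Summits.HodgeConjecture.HodgeConjecture.Theorems.F0P3cStCharTSJetAtDatum -- ★ row 27 J2 (F0P2-p02 (g25)): `exists_linearEquiv_normalizedInd_cmBorel_unipotentModel_jet` (brings ★ J1 + ★ `UnitaryGroupBorelInduction`)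
import Summits.HodgeConjecture.HodgeConjecture.Theorems.F0P3cStCharTSHeightAtDatum -- ★ row 27b H2 (this seat) p853199: `exists_height_cmBorel` (the height `Λ` at the datum)
import HarnessLib

/-!
# The jet window AT THE CM DATUM: rows 21 ∕ 26 ∕ 32 («deforms ⟺ coboundary ⟺ transversal ⟺ section»; «not deforms ⇒ not filled») for `A := range f`,
# `f` an intertwiner into `i_B(σ₀)` on `U(Φ_N)(L⁺_v)`, along the height jet `(i_B σ₀, π₁)` of ★ J1∕J2 — with `π₁ 1 = 0` and Leibniz DERIVED from the height formula

Cell `pub/hodgecm-mathlib`, crux H413 = `stmt-HodgeConjecture-24833` (`--supports` lane, helper, THEOREMS ONLY: no definition ∕ instance ∕ notation ∕ named fact ∕ `sorry`).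
Namespace `Summit.HodgeConjecture.HodgeConjecture.Cruxes.H413.F0P3cStCharTSJetWindowAtDatum`.  E1 BRICK LEDGER (F0P3a-p03 (g29)) row 27c, the shape-(c) datum twin of
★ rows 21 (JET-WINDOW `FirstOrderDeformationInvariantSubspace`), 26 (TRANSVERSAL `CocycleExtensionTransversal`), 32 (WINDOW TRANSFER `JetWindowTransfer`) at the CM
datum of ★ row 27 J2 `F0P3cStCharTSJetAtDatum` (F0P2-p02 (g25)) and ★ row 27b H2 `F0P3cStCharTSHeightAtDatum` (this seat).  Seat F0P3b-p01 (g25).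

THE MATHEMATICS (census «JET @ DATUM» v1 §(δ)).  The generic rows consume a jet pair `(π₀, π₁)` (`π₁ 1 = 0`, Leibniz `π₁(gh) = π₁(g)π₀(h) + π₀(g)π₁(h)`), its jet
representation `ρ` on `V × V` (`ρ g (v₀, v₁) = (π₀ g v₀, π₁ g v₀ + π₀ g v₁)`) and a `π₀`-INVARIANT submodule `A ≤ V` projective over `k`; at the datum `k = ℂ` (projectivity is
automatic), `V = i_B(σ₀)` (`normalizedInd (cmBorelTriple L N v) σ₀`; `σ₀ = χ̃` gives ★ `cmPrincipalSeries L N v χ`, `rfl`), `π₁` = the HEIGHT JET `(π₁ g v)(x) = (Λ(xg) − Λ(x))·v(xg)`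
of ★ J1∕J2 for the height `Λ` of ★ H2, and `A := range f` for an INTERTWINER `f : W → V` of a representation `τ` into `π₀` («the `Submodule` is `LinearMap.range`, invariance =
equivariance») — at `N = 3` the embedding of a constituent `π²(ξ) ↪ i_B(χ_ξ)` of ★-hyp `U3PrincipalSeriesConstituentEmbeds` ∕ the pins `hKeysJH`, `eLab`; for the K4′ spine
`A := π⁺ = ker(𝒜₀ − 1)` for an intertwining operator `𝒜₀` (JET-SIGN §4).  This file supplies: §1 the two invariance lemmas and «`π₁ 1 = 0` + Leibniz FROM THE HEIGHT
FORMULA» (so a consumer holding only J2's formula clause `hπ₁` has `h1`, `hL`); §2 the `A := range f` readings of rows 32 ∕ 26 ∕ 21 (any `k`, any jet pair); §3 the same three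
along the height jet of `i_P(σ₀)` for ANY parabolic triple (the CM datum is `t := cmBorelTriple L N v`), hypothesis-style in `(π₁, hπ₁, ρ, hρ)` exactly as ★ J1 (H3) — so they apply verbatim to the components `obtain`ed from ★ J2's packages
(`exists_linearEquiv_normalizedInd_cmBorel_unipotentModel_jet`, `exists_linearEquiv_cmPrincipalSeries_unipotentModel_jet`; never re-spell those ∃-types — measured whnf wall).
* §1 `range_le_comap_of_isIntertwining`, `ker_sub_one_le_comap_of_commute`, **`jet_one_eq_zero_of_height_formula`**, **`jet_leibniz_of_height_formula`**.
* §2 **`not_fills_range_of_not_deforms`** (row 32 read with `a = f w`), `exists_invariant_transversal_range_iff_deforms` (row 26), `not_exists_equivariant_section_range_of_not_deforms` (row 21).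
* §3 (ANY parabolic triple `t`, `π₀ = normalizedInd t σ₀`, J2 §1 letters) `jet_one_eq_zero_and_leibniz_normalizedInd`, **`not_fills_range_of_not_deforms_normalizedInd`**,
  `exists_invariant_transversal_range_iff_deforms_normalizedInd`, `not_exists_equivariant_section_range_of_not_deforms_normalizedInd`; §4 at `t := cmBorelTriple L N v`
  `jet_one_eq_zero_and_leibniz_cmBorel` (the datum instance is ONE LINE from §3 — `(cmBorelTriple L N v)` for `t` —, exactly as ★ J2 §2 instantiates J2 §1; re-spelling the §3
  heads with `cmBorelTriple` unfolded in the binders hits the whnf wall J2's §3 note documents, so consumers call §3 with `t := cmBorelTriple L N v`).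
The representation-theoretic INPUT the consumers still wait for is unchanged and PRINT: «`A` does NOT deform to first order» (`hnd`) ⟸ the simple zero ∕ non-scalar `𝒜₀`
[Keys1984] — (A4); nothing here discharges it.
[cite: HuybrechtsLehn1997, App. 2.A.7 (Flags of subsheaves)] [cite: Brown1982, Ch. IV §2 Prop. 2.3 p. 89] [cite: Keys1984, §3 pp. 118–119] [cite: BernsteinZelevinsky1977, §2.3]
[cite: Rogawski1990, §12.2 p. 173]
HONEST LABEL: count-neutral datum dress; h413 OPEN; HC_CM is proved only modulo the 7 printed citations (2 remaining named inputs hLiu418 = stmt-HodgeConjecture-24832,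
h413 = stmt-HodgeConjecture-24833) until rung 0 closes.

## References
* [HuybrechtsLehn1997] D. Huybrechts, M. Lehn, *The Geometry of Moduli Spaces of Sheaves* (1997), Appendix 2.A.7 (Flags of subsheaves).
* [Brown1982] K. S. Brown, *Cohomology of Groups*, GTM 87 (1982), Ch. IV §2, Prop. 2.3 p. 89.
* [Keys1984] D. Keys, *Principal series representations of special unitary groups over local fields*, Compositio Math. 51 (1984), §3 pp. 118–119.
* [BernsteinZelevinsky1977] I. N. Bernstein, A. V. Zelevinsky, *Induced representations of reductive p-adic groups I*, Ann. Sci. ÉNS 10 (1977), §2.3.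
* [Rogawski1990] J. D. Rogawski, *Automorphic Representations of Unitary Groups in Three Variables*, Ann. of Math. Stud. 123 (1990), §12.2 p. 173.
-/

set_option autoImplicit false

set_option linter.dupNamespace false

noncomputable section

open NumberField IsDedekindDomain

namespace Summit.HodgeConjecture.HodgeConjecture.Cruxes.H413.F0P3cStCharTSJetWindowAtDatum

open Literature.NumberTheory.Automorphic Literature.NumberTheory.Automorphic.UnitaryGroup Representation Literature.RepresentationTheory

/-! ## §1 Glue: invariance of `range f` and of `ker(𝒜₀ − 1)`; `π₁ 1 = 0` and Leibniz from the height formula -/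

section Glue

variable {k : Type*} [CommRing k] {G : Type*} [Monoid G] {V W : Type*} [AddCommGroup V] [Module k V] [AddCommGroup W] [Module k W]

/-- **«THE SUBMODULE IS `range f`, INVARIANCE = EQUIVARIANCE»**: the range of a `k`-linear map intertwining `τ` with `π₀` is `π₀`-invariant (the `hA`-binder of ★ rows 21∕26∕32).
[cite: HuybrechtsLehn1997, App. 2.A.7 (Flags of subsheaves)] -/
theorem range_le_comap_of_isIntertwining (π₀ : Representation k G V) (τ : Representation k G W) (f : W →ₗ[k] V)
    (hf : ∀ (g : G) (w : W), f (τ g w) = π₀ g (f w)) (g : G) : LinearMap.range f ≤ (LinearMap.range f).comap (π₀ g) := by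
  rintro _ ⟨w, rfl⟩
  exact ⟨τ g w, hf g w⟩

/-- **THE `+1`-EIGENSPACE `π⁺ = ker(𝒜₀ − 1)` OF A COMMUTING OPERATOR IS INVARIANT** (the K4′ spine's `A`, JET-SIGN §4 letters): if `𝒜₀ π₀(g) = π₀(g) 𝒜₀` for all `g` then
`ker(𝒜₀ − 1)` is `π₀`-invariant. [cite: Keys1984, §3 pp. 118–119] -/
theorem ker_sub_one_le_comap_of_commute (π₀ : Representation k G V) (A₀ : Module.End k V) (hA₀ : ∀ g : G, A₀ * π₀ g = π₀ g * A₀) (g : G) :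
    LinearMap.ker (A₀ - 1) ≤ (LinearMap.ker (A₀ - 1)).comap (π₀ g) := by
  intro x hx
  rw [LinearMap.mem_ker, LinearMap.sub_apply, Module.End.one_apply, sub_eq_zero] at hx
  rw [Submodule.mem_comap, LinearMap.mem_ker, LinearMap.sub_apply, Module.End.one_apply, sub_eq_zero, ← Module.End.mul_apply, hA₀,
    Module.End.mul_apply, hx]

end Glue

section HeightFormula

variable {k : Type*} [CommRing k] {G : Type*} [Group G] [TopologicalSpace G] [IsTopologicalGroup G] {W : Type*} [AddCommGroup W] [Module k W]
  (H : Subgroup G) (σ : Representation k H W) (Λ : G → k)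
  (π₁ : G → Module.End k (SmoothInd H σ)) (hπ₁ : ∀ (g : G) (v : SmoothInd H σ) (x : G), (π₁ g v).toFun x = (Λ (x * g) - Λ x) • v.toFun (x * g))

include hπ₁ in
/-- **`π₁ 1 = 0` FROM THE HEIGHT FORMULA** `(π₁ g v)(x) = (Λ(xg) − Λ(x))·v(xg)` (ANY `π₁` with ★ J1's (H2) formula clause). [cite: Keys1984, §3 pp. 118–119] [cite: BernsteinZelevinsky1977, §2.3] -/
theorem jet_one_eq_zero_of_height_formula : π₁ 1 = 0 := by
  refine LinearMap.ext fun v => SmoothInd.ext (funext fun x => ?_)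
  rw [hπ₁, mul_one, sub_self, zero_smul]
  rfl

include hπ₁ in
/-- **LEIBNIZ FROM THE HEIGHT FORMULA**: `π₁ (g h) = π₁ g * R_h + R_g * π₁ h` (`R = Ind_H^G σ`) — the cocycle identity `Λ(xgh) − Λ(x) = (Λ(xgh) − Λ(xg)) + (Λ(xg) − Λ(x))`.
(ANY `π₁` with ★ J1's (H2) formula clause.) [cite: Keys1984, §3 pp. 118–119] [cite: BernsteinZelevinsky1977, §2.3] -/
theorem jet_leibniz_of_height_formula (g h : G) : π₁ (g * h) = π₁ g * smoothIndRep H σ h + smoothIndRep H σ g * π₁ h := by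
  refine LinearMap.ext fun v => SmoothInd.ext (funext fun x => ?_)
  have e2 : ((π₁ g * smoothIndRep H σ h + smoothIndRep H σ g * π₁ h) v).toFun x =
      (Λ (x * g) - Λ x) • v.toFun (x * g * h) + (Λ (x * g * h) - Λ (x * g)) • v.toFun (x * g * h) := by
    rw [LinearMap.add_apply, SmoothInd.toFun_add, Pi.add_apply, Module.End.mul_apply, Module.End.mul_apply, hπ₁, toFun_smoothIndRep_apply,
      toFun_smoothIndRep_apply, hπ₁]
  rw [hπ₁, e2, ← add_smul, ← mul_assoc]
  congr 1
  abel

end HeightFormula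

/-! ## §2 The `A := range f` readings of rows 32 ∕ 26 ∕ 21 (any `k`, any jet pair) -/

section RangeReadings

variable {k : Type*} [CommRing k] {G : Type*} [Monoid G] {V W X : Type*} [AddCommGroup V] [Module k V] [AddCommGroup W] [Module k W]
  [AddCommGroup X] [Module k X]
  (π₀ : Representation k G V) (π₁ : G → Module.End k V) (τ : Representation k G W) (f : W →ₗ[k] V)
  (hf : ∀ (g : G) (w : W), f (τ g w) = π₀ g (f w))

/-- **ROW 32 AT `A := range f`: NOT DEFORMS ⇒ NOT FILLED.**  If `range f` does NOT deform to first order along `(π₀, π₁)` (`range f` projective over `k`), then an equivariant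
`φ : X → V × V` into the jet representation `ρ` whose first components lie in `range f` and which meets `0 × V` only inside `0 × range f` misses some `f w`:
`∃ w, ∀ x, (φ x).1 ≠ f w` (★ `not_fills_of_not_deforms` read with `a = f w`). [cite: HuybrechtsLehn1997, App. 2.A.7 (Flags of subsheaves)] [cite: Brown1982, Ch. IV §2 Prop. 2.3 p. 89] -/
theorem not_fills_range_of_not_deforms (h1 : π₁ 1 = 0) (hL : ∀ g h, π₁ (g * h) = π₁ g * π₀ h + π₀ g * π₁ h) (ρ : Representation k G (V × V))
    (hρ : ∀ g v₀ v₁, ρ g (v₀, v₁) = (π₀ g v₀, π₁ g v₀ + π₀ g v₁)) [Module.Projective k (LinearMap.range f)]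
    (hnd : ¬ ∃ L : LinearMap.range f →ₗ[k] V, ∀ (g : G) (a : LinearMap.range f),
      π₁ g (a : V) + π₀ g (L a) - L (π₀.subrepresentation (LinearMap.range f) (range_le_comap_of_isIntertwining π₀ τ f hf) g a) ∈ LinearMap.range f)
    (τ' : Representation k G X) (φ : X →ₗ[k] V × V) (hφ : ∀ g x, φ (τ' g x) = ρ g (φ x)) (hA : ∀ x, (φ x).1 ∈ LinearMap.range f)
    (hmeet : ∀ x, (φ x).1 = 0 → (φ x).2 ∈ LinearMap.range f) :
    ∃ w : W, ∀ x, (φ x).1 ≠ f w := by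
  obtain ⟨a, ha, hne⟩ := not_fills_of_not_deforms π₀ π₁ h1 hL ρ hρ (LinearMap.range f) (range_le_comap_of_isIntertwining π₀ τ f hf) hnd
    τ' φ hφ hA hmeet
  obtain ⟨w, rfl⟩ := LinearMap.mem_range.1 ha
  exact ⟨w, hne⟩

/-- **ROW 26 AT `A := range f`: INVARIANT TRANSVERSAL IN THE WINDOW ⟺ `range f` DEFORMS TO FIRST ORDER** (`range f` projective over `k`; `E` the window model on
`(V ⧸ range f) × range f` with block cocycle `c g = mkQ ∘ π₁ g ∘ ι`). [cite: HuybrechtsLehn1997, App. 2.A.7 (Flags of subsheaves)] [cite: Brown1982, Ch. IV §2 Prop. 2.3 p. 89] -/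
theorem exists_invariant_transversal_range_iff_deforms [Module.Projective k (LinearMap.range f)]
    (c : G → LinearMap.range f →ₗ[k] V ⧸ LinearMap.range f) (hc : ∀ g, c g = (LinearMap.range f).mkQ ∘ₗ π₁ g ∘ₗ (LinearMap.range f).subtype)
    (E : Representation k G ((V ⧸ LinearMap.range f) × LinearMap.range f))
    (hE : ∀ g u a, E g (u, a) = (π₀.quotient (LinearMap.range f) (range_le_comap_of_isIntertwining π₀ τ f hf) g u + c g a,
      π₀.subrepresentation (LinearMap.range f) (range_le_comap_of_isIntertwining π₀ τ f hf) g a)) :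
    (∃ S : Submodule k ((V ⧸ LinearMap.range f) × LinearMap.range f), (∀ g, S ≤ S.comap (E g)) ∧
        Disjoint S (LinearMap.ker (LinearMap.snd k (V ⧸ LinearMap.range f) (LinearMap.range f))) ∧
          S.map (LinearMap.snd k (V ⧸ LinearMap.range f) (LinearMap.range f)) = ⊤) ↔
      ∃ L : LinearMap.range f →ₗ[k] V, ∀ (g : G) (a : LinearMap.range f),
        π₁ g (a : V) + π₀ g (L a) - L (π₀.subrepresentation (LinearMap.range f) (range_le_comap_of_isIntertwining π₀ τ f hf) g a) ∈ LinearMap.range f :=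
  exists_invariant_transversal_jetWindow_iff_deforms π₀ π₁ (LinearMap.range f) (range_le_comap_of_isIntertwining π₀ τ f hf) c hc E hE

/-- **ROW 21 AT `A := range f`: NOT DEFORMS ⇒ THE WINDOW EXTENSION DOES NOT SPLIT** — no equivariant `k`-linear section of `snd : E → range f` (`range f` projective over `k`).
[cite: HuybrechtsLehn1997, App. 2.A.7 (Flags of subsheaves)] [cite: Brown1982, Ch. IV §2 Prop. 2.3 p. 89] -/
theorem not_exists_equivariant_section_range_of_not_deforms [Module.Projective k (LinearMap.range f)]
    (c : G → LinearMap.range f →ₗ[k] V ⧸ LinearMap.range f) (hc : ∀ g, c g = (LinearMap.range f).mkQ ∘ₗ π₁ g ∘ₗ (LinearMap.range f).subtype)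
    (E : Representation k G ((V ⧸ LinearMap.range f) × LinearMap.range f))
    (hE : ∀ g u a, E g (u, a) = (π₀.quotient (LinearMap.range f) (range_le_comap_of_isIntertwining π₀ τ f hf) g u + c g a,
      π₀.subrepresentation (LinearMap.range f) (range_le_comap_of_isIntertwining π₀ τ f hf) g a))
    (hnd : ¬ ∃ L : LinearMap.range f →ₗ[k] V, ∀ (g : G) (a : LinearMap.range f),
      π₁ g (a : V) + π₀ g (L a) - L (π₀.subrepresentation (LinearMap.range f) (range_le_comap_of_isIntertwining π₀ τ f hf) g a) ∈ LinearMap.range f) :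
    ¬ ∃ s : LinearMap.range f →ₗ[k] (V ⧸ LinearMap.range f) × LinearMap.range f, (∀ a, (s a).2 = a) ∧
        ∀ g a, E g (s a) = s (π₀.subrepresentation (LinearMap.range f) (range_le_comap_of_isIntertwining π₀ τ f hf) g a) :=
  not_exists_equivariant_section_of_not_deforms π₀ π₁ (LinearMap.range f) (range_le_comap_of_isIntertwining π₀ τ f hf) c hc E hE hnd

end RangeReadings

/-! ## §3 ALONG THE HEIGHT JET OF `i_P(σ₀)` FOR ANY PARABOLIC TRIPLE `t` (J2 §1 letters): `π₀ = normalizedInd t σ₀`, `π₁` with the height formula `hπ₁` only -/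

section AnyTriple

variable {G : Type*} [Group G] [TopologicalSpace G] [IsTopologicalGroup G] (t : ParabolicTriple G) [LocallyCompactSpace ↥t.P]
  {W₀ : Type*} [AddCommGroup W₀] [Module ℂ W₀] (σ₀ : Representation ℂ ↥t.M W₀) (Λ : G → ℂ)
  (π₁ : G → Module.End ℂ (SmoothInd t.P (Representation.twist (σ₀.comp t.proj) (rootDeltaChar t.P))))
  (hπ₁ : ∀ (g : G) (w : SmoothInd t.P (Representation.twist (σ₀.comp t.proj) (rootDeltaChar t.P))) (x : G),
    (π₁ g w).toFun x = (Λ (x * g) - Λ x) • w.toFun (x * g))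
  (ρ : Representation ℂ G (SmoothInd t.P (Representation.twist (σ₀.comp t.proj) (rootDeltaChar t.P)) ×
    SmoothInd t.P (Representation.twist (σ₀.comp t.proj) (rootDeltaChar t.P))))
  (hρ : ∀ g v₀ v₁, ρ g (v₀, v₁) = (Representation.normalizedInd t σ₀ g v₀, π₁ g v₀ + Representation.normalizedInd t σ₀ g v₁))
  {W : Type*} [AddCommGroup W] [Module ℂ W] (τ : Representation ℂ G W)
  (f : W →ₗ[ℂ] SmoothInd t.P (Representation.twist (σ₀.comp t.proj) (rootDeltaChar t.P)))
  (hf : ∀ (g : G) (w : W), f (τ g w) = Representation.normalizedInd t σ₀ g (f w))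

include hπ₁ in
/-- `π₁ 1 = 0` and Leibniz for the height jet of `i_P(σ₀)`, from the formula clause `hπ₁` alone (`normalizedInd t σ₀ = smoothIndRep t.P (…)` by `rfl`; ANY `π₁`, as ★ J1 (H3)).
[cite: Keys1984, §3 pp. 118–119] [cite: BernsteinZelevinsky1977, §2.3] -/
theorem jet_one_eq_zero_and_leibniz_normalizedInd :
    π₁ 1 = 0 ∧ ∀ g h, π₁ (g * h) = π₁ g * Representation.normalizedInd t σ₀ h + Representation.normalizedInd t σ₀ g * π₁ h :=
  ⟨jet_one_eq_zero_of_height_formula t.P _ Λ π₁ hπ₁, jet_leibniz_of_height_formula t.P _ Λ π₁ hπ₁⟩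

include hπ₁ hρ hf in
/-- **ROW 32 ALONG THE HEIGHT JET OF `i_P(σ₀)`: if `range f ⊂ i_P(σ₀)` does NOT deform to first order, no equivariant `φ : X → i_P(σ₀) × i_P(σ₀)` into the jet representation
with first components in `range f` and `φ(X) ∩ (0 × V) ⊆ 0 × range f` fills `range f`** — `∃ w, ∀ x, (φ x).1 ≠ f w`.  At the CM datum `t := cmBorelTriple L N v`
(`G = U(Φ_N)(L⁺_v)`), `N = 3`, `σ₀ = χ̃_ξ`, `f` = the embedding `π²(ξ) ↪ i_B(χ_ξ)`: the K2′-π² «no equivariant lift through the window» sentence, modulo (A4) (`hnd`, PRINT [Keys1984]);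
`(Λ, π₁, ρ)` = the components of ★ J2's package ∕ ★ H2's height. [cite: HuybrechtsLehn1997, App. 2.A.7 (Flags of subsheaves)] [cite: Keys1984, §3 pp. 118–119] [cite: Rogawski1990, §12.2 p. 173] -/
theorem not_fills_range_of_not_deforms_normalizedInd
    (hnd : ¬ ∃ Lft : LinearMap.range f →ₗ[ℂ] SmoothInd t.P (Representation.twist (σ₀.comp t.proj) (rootDeltaChar t.P)),
      ∀ (g : G) (a : LinearMap.range f),
        π₁ g (a : SmoothInd t.P (Representation.twist (σ₀.comp t.proj) (rootDeltaChar t.P))) + Representation.normalizedInd t σ₀ g (Lft a) -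
          Lft ((Representation.normalizedInd t σ₀).subrepresentation (LinearMap.range f)
            (range_le_comap_of_isIntertwining (Representation.normalizedInd t σ₀) τ f hf) g a) ∈ LinearMap.range f)
    {X : Type*} [AddCommGroup X] [Module ℂ X] (τ' : Representation ℂ G X)
    (φ : X →ₗ[ℂ] SmoothInd t.P (Representation.twist (σ₀.comp t.proj) (rootDeltaChar t.P)) × SmoothInd t.P (Representation.twist (σ₀.comp t.proj) (rootDeltaChar t.P)))
    (hφ : ∀ g x, φ (τ' g x) = ρ g (φ x)) (hA : ∀ x, (φ x).1 ∈ LinearMap.range f) (hmeet : ∀ x, (φ x).1 = 0 → (φ x).2 ∈ LinearMap.range f) :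
    ∃ w : W, ∀ x, (φ x).1 ≠ f w :=
  not_fills_range_of_not_deforms (Representation.normalizedInd t σ₀) π₁ τ f hf
    (jet_one_eq_zero_of_height_formula t.P _ Λ π₁ hπ₁) (jet_leibniz_of_height_formula t.P _ Λ π₁ hπ₁) ρ hρ hnd τ' φ hφ hA hmeet

include hf in
/-- **ROW 26 ALONG THE HEIGHT JET OF `i_P(σ₀)`: an invariant transversal in the window model over `range f ⊂ i_P(σ₀)` exists iff `range f` deforms to first order** (`E` the
window representation on `(V ⧸ range f) × range f` with block cocycle `c g = mkQ ∘ π₁ g ∘ ι`). [cite: HuybrechtsLehn1997, App. 2.A.7 (Flags of subsheaves)] [cite: Keys1984, §3 pp. 118–119]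
[cite: Rogawski1990, §12.2 p. 173] -/
theorem exists_invariant_transversal_range_iff_deforms_normalizedInd
    (c : G → LinearMap.range f →ₗ[ℂ] SmoothInd t.P (Representation.twist (σ₀.comp t.proj) (rootDeltaChar t.P)) ⧸ LinearMap.range f)
    (hc : ∀ g, c g = (LinearMap.range f).mkQ ∘ₗ π₁ g ∘ₗ (LinearMap.range f).subtype)
    (E : Representation ℂ G ((SmoothInd t.P (Representation.twist (σ₀.comp t.proj) (rootDeltaChar t.P)) ⧸ LinearMap.range f) × LinearMap.range f))
    (hE : ∀ g u a, E g (u, a) = ((Representation.normalizedInd t σ₀).quotient (LinearMap.range f)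
        (range_le_comap_of_isIntertwining (Representation.normalizedInd t σ₀) τ f hf) g u + c g a,
      (Representation.normalizedInd t σ₀).subrepresentation (LinearMap.range f) (range_le_comap_of_isIntertwining (Representation.normalizedInd t σ₀) τ f hf) g a)) :
    (∃ S : Submodule ℂ ((SmoothInd t.P (Representation.twist (σ₀.comp t.proj) (rootDeltaChar t.P)) ⧸ LinearMap.range f) × LinearMap.range f),
        (∀ g, S ≤ S.comap (E g)) ∧ Disjoint S (LinearMap.ker (LinearMap.snd ℂ _ (LinearMap.range f))) ∧ S.map (LinearMap.snd ℂ _ (LinearMap.range f)) = ⊤) ↔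
      ∃ Lft : LinearMap.range f →ₗ[ℂ] SmoothInd t.P (Representation.twist (σ₀.comp t.proj) (rootDeltaChar t.P)), ∀ (g : G) (a : LinearMap.range f),
        π₁ g (a : SmoothInd t.P (Representation.twist (σ₀.comp t.proj) (rootDeltaChar t.P))) + Representation.normalizedInd t σ₀ g (Lft a) -
          Lft ((Representation.normalizedInd t σ₀).subrepresentation (LinearMap.range f)
            (range_le_comap_of_isIntertwining (Representation.normalizedInd t σ₀) τ f hf) g a) ∈ LinearMap.range f :=
  exists_invariant_transversal_range_iff_deforms (Representation.normalizedInd t σ₀) π₁ τ f hf c hc E hE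

include hf in
/-- **ROW 21 ALONG THE HEIGHT JET OF `i_P(σ₀)`: if `range f ⊂ i_P(σ₀)` does NOT deform to first order, the window extension of `range f` by `i_P(σ₀) ∕ range f` does NOT split** (no
equivariant section of `snd`).  At the CM datum, `N = 3`, `f : π²(ξ) ↪ i_B(χ_ξ)`: «the window is a non-split extension», modulo (A4).
[cite: HuybrechtsLehn1997, App. 2.A.7 (Flags of subsheaves)] [cite: Keys1984, §3 pp. 118–119] [cite: Rogawski1990, §12.2 p. 173] -/
theorem not_exists_equivariant_section_range_of_not_deforms_normalizedInd
    (c : G → LinearMap.range f →ₗ[ℂ] SmoothInd t.P (Representation.twist (σ₀.comp t.proj) (rootDeltaChar t.P)) ⧸ LinearMap.range f)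
    (hc : ∀ g, c g = (LinearMap.range f).mkQ ∘ₗ π₁ g ∘ₗ (LinearMap.range f).subtype)
    (E : Representation ℂ G ((SmoothInd t.P (Representation.twist (σ₀.comp t.proj) (rootDeltaChar t.P)) ⧸ LinearMap.range f) × LinearMap.range f))
    (hE : ∀ g u a, E g (u, a) = ((Representation.normalizedInd t σ₀).quotient (LinearMap.range f)
        (range_le_comap_of_isIntertwining (Representation.normalizedInd t σ₀) τ f hf) g u + c g a,
      (Representation.normalizedInd t σ₀).subrepresentation (LinearMap.range f) (range_le_comap_of_isIntertwining (Representation.normalizedInd t σ₀) τ f hf) g a))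
    (hnd : ¬ ∃ Lft : LinearMap.range f →ₗ[ℂ] SmoothInd t.P (Representation.twist (σ₀.comp t.proj) (rootDeltaChar t.P)), ∀ (g : G) (a : LinearMap.range f),
      π₁ g (a : SmoothInd t.P (Representation.twist (σ₀.comp t.proj) (rootDeltaChar t.P))) + Representation.normalizedInd t σ₀ g (Lft a) -
        Lft ((Representation.normalizedInd t σ₀).subrepresentation (LinearMap.range f)
          (range_le_comap_of_isIntertwining (Representation.normalizedInd t σ₀) τ f hf) g a) ∈ LinearMap.range f) :
    ¬ ∃ s : LinearMap.range f →ₗ[ℂ] (SmoothInd t.P (Representation.twist (σ₀.comp t.proj) (rootDeltaChar t.P)) ⧸ LinearMap.range f) × LinearMap.range f,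
        (∀ a, (s a).2 = a) ∧ ∀ g a, E g (s a) = s ((Representation.normalizedInd t σ₀).subrepresentation (LinearMap.range f)
          (range_le_comap_of_isIntertwining (Representation.normalizedInd t σ₀) τ f hf) g a) :=
  not_exists_equivariant_section_range_of_not_deforms (Representation.normalizedInd t σ₀) π₁ τ f hf c hc E hE hnd

end AnyTriple

/-! ## §4 AT THE CM DATUM `t := cmBorelTriple L N v` (`G = U(Φ_N)(L⁺_v)`): the row-32 reading, one line from §3 -/

section Datum

variable (L : Type) [Field L] [NumberField L] [IsCMField L] (N : ℕ) (v : HeightOneSpectrum (𝓞 ↥(maximalRealSubfield L)))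
  [LocallyCompactSpace ↥(borelU (conjLocal L (IsCMField.complexConj L) v) (cmLocalForm L N v))]
  {W₀ : Type*} [AddCommGroup W₀] [Module ℂ W₀] (σ₀ : Representation ℂ ↥(cmBorelTriple L N v).M W₀)
  (Λ : ↥(unitaryGroupOfForm (conjLocal L (IsCMField.complexConj L) v) (cmLocalForm L N v)) → ℂ)
  (π₁ : ↥(unitaryGroupOfForm (conjLocal L (IsCMField.complexConj L) v) (cmLocalForm L N v)) →
    Module.End ℂ (SmoothInd (cmBorelTriple L N v).P (Representation.twist (σ₀.comp (cmBorelTriple L N v).proj) (rootDeltaChar (cmBorelTriple L N v).P))))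
  (hπ₁ : ∀ (g : ↥(unitaryGroupOfForm (conjLocal L (IsCMField.complexConj L) v) (cmLocalForm L N v)))
    (w : SmoothInd (cmBorelTriple L N v).P (Representation.twist (σ₀.comp (cmBorelTriple L N v).proj) (rootDeltaChar (cmBorelTriple L N v).P)))
    (x : ↥(unitaryGroupOfForm (conjLocal L (IsCMField.complexConj L) v) (cmLocalForm L N v))), (π₁ g w).toFun x = (Λ (x * g) - Λ x) • w.toFun (x * g))

include hπ₁ in
/-- `π₁ 1 = 0` and Leibniz for the height jet of `i_B(σ₀)` on `U(Φ_N)(L⁺_v)` from ★ J2's formula clause `hπ₁` (its other clauses are then REDUNDANT for consumers of rows 21∕26∕32).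
[cite: Keys1984, §3 pp. 118–119] [cite: BernsteinZelevinsky1977, §2.3] [cite: Rogawski1990, §12.2 p. 173] -/
theorem jet_one_eq_zero_and_leibniz_cmBorel :
    π₁ 1 = 0 ∧ ∀ g h, π₁ (g * h) = π₁ g * Representation.normalizedInd (cmBorelTriple L N v) σ₀ h + Representation.normalizedInd (cmBorelTriple L N v) σ₀ g * π₁ h :=
  jet_one_eq_zero_and_leibniz_normalizedInd (cmBorelTriple L N v) σ₀ Λ π₁ hπ₁

end Datum

end Summit.HodgeConjecture.HodgeConjecture.Cruxes.H413.F0P3cStCharTSJetWindowAtDatum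

end
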